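import Mathlib
import Summits.AtomisticToContinuum.Crystallization.Theorems.PhononStability.Negative.Mirror

/-!
# Crux `NashNearField` (stmt-AtomisticToContinuum-16827), line `birth`: per-bond stiffness bounds for the tube-coercivity input of
# `stub_nashFlatnessPaid` (I_flat) at goodness tolerance `1/40`

The perturbative step of (I_flat) needs the frozen-exterior Lennard-Jones Hessian to be coercive at tube states of goodness tolerance
`≈ 1/40` (TC@1/40, the shared analytic input proposed in `Cruxes/NashNearField/TC_SHARED_ITEM.md`), where first-shell bond lengths lie
in `[19/20, 21/20]` (times the local scale).  Any certificate splits the pair force-constant form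
`Hess₀ e w = V″(|e|)(ê·w)² + (V′(|e|)/|e|)(|w|² − (ê·w)²)` (`…PhononStabilityNegative.Hess₀`) into its longitudinal and transverse
parts and needs explicit constants for both coefficients on that interval.  This file certifies them (exact rational arithmetic,
monotonicity replaced by endpoint domination):

* `lj_deriv2_ge_on_tube40` — `9/5 ≤ V″(r) = 13r⁻¹⁴ − 7r⁻⁸` for `19/20 ≤ r ≤ 21/20` (true minimum `V″(21/20) ≈ 1.83`);
* `lj_deriv2_le_on_tube40` — `V″(r) ≤ 33/2` there (true maximum `V″(19/20) ≈ 16.1`);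
* `lj_deriv_div_ge_on_tube40` — `−14/25 ≤ V′(r)/r = −r⁻¹⁴ + r⁻⁸` there (true minimum `≈ −0.543` at `19/20`);
* `lj_deriv_div_le_on_tube40` — `V′(r)/r ≤ 13/50` there (true maximum `≈ 0.172` at `21/20`);
* `Hess₀_ge_split_on_tube40` — hence `Hess₀ e w ≥ (9/5)·c² − (14/25)·(‖w‖² − c²)`, `c = ⟪e, w⟫/‖e‖`, for `‖e‖ ∈ [19/20, 21/20]`,
  and `Hess₀_ge_neg_on_tube40` — `Hess₀ e w ≥ −(14/25)‖w‖²`: a first-shell bond never costs more than `0.56‖Δu‖²`, and gains at least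
  `1.8` per unit squared stretch.
All `[folklore]` calculus; `--as helper` pieces for the line's energy stub.
-/

noncomputable section

open Literature.MathematicalPhysics.StatisticalMechanics

namespace Summit.AtomisticToContinuum.Crystallization.Theorems.NashClassCertificatesNashNearField

open Summit.AtomisticToContinuum.Crystallization.Theorems.PhononStabilityNegative

/-- `9/5 ≤ V″(r)` on `[19/20, 21/20]`. [folklore] -/
theorem lj_deriv2_ge_on_tube40 {r : ℝ} (h1 : 19 / 20 ≤ r) (h2 : r ≤ 21 / 20) :
    9 / 5 ≤ deriv (deriv lennardJones) r := by
  have hr : 0 < r := by linarith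
  rw [deriv_deriv_lennardJones hr.ne']
  -- `13 r⁻¹⁴ − 7 r⁻⁸ ≥ 9/5  ⟸  13 − 7 r⁶ ≥ (9/5) r¹⁴` with `r ≤ 21/20`
  have h6 : r ^ 6 ≤ (21 / 20 : ℝ) ^ 6 := pow_le_pow_left₀ hr.le h2 6
  have h14 : r ^ 14 ≤ (21 / 20 : ℝ) ^ 14 := pow_le_pow_left₀ hr.le h2 14
  have hkey : (9 / 5 : ℝ) * r ^ 14 ≤ 13 - 7 * r ^ 6 := by
    have hc : (9 / 5 : ℝ) * (21 / 20 : ℝ) ^ 14 ≤ 13 - 7 * (21 / 20 : ℝ) ^ 6 := by norm_num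
    nlinarith
  have hr14 : 0 < r ^ 14 := by positivity
  have hinv : (r⁻¹) ^ 14 = (r ^ 14)⁻¹ := by rw [inv_pow]
  have hinv8 : (r⁻¹) ^ 8 = r ^ 6 * (r ^ 14)⁻¹ := by
    rw [inv_pow]; field_simp
  rw [hinv, hinv8]
  rw [show (13 : ℝ) * (r ^ 14)⁻¹ - 7 * (r ^ 6 * (r ^ 14)⁻¹) = (13 - 7 * r ^ 6) * (r ^ 14)⁻¹ by ring]
  rw [le_mul_inv_iff₀ hr14]
  linarith

/-- `V″(r) ≤ 33/2` on `[19/20, 21/20]`. [folklore] -/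
theorem lj_deriv2_le_on_tube40 {r : ℝ} (h1 : 19 / 20 ≤ r) (h2 : r ≤ 21 / 20) :
    deriv (deriv lennardJones) r ≤ 33 / 2 := by
  have hr : 0 < r := by linarith
  have _h := h2
  rw [deriv_deriv_lennardJones hr.ne']
  -- `13 r⁻¹⁴ − 7 r⁻⁸ ≤ 33/2 ⟸ 13 − 7 r⁶ ≤ (33/2) r¹⁴` with `r ≥ 19/20`
  have h6 : (19 / 20 : ℝ) ^ 6 ≤ r ^ 6 := pow_le_pow_left₀ (by norm_num) h1 6
  have h14 : (19 / 20 : ℝ) ^ 14 ≤ r ^ 14 := pow_le_pow_left₀ (by norm_num) h1 14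
  have hkey : 13 - 7 * r ^ 6 ≤ (33 / 2 : ℝ) * r ^ 14 := by
    have hc : 13 - 7 * (19 / 20 : ℝ) ^ 6 ≤ (33 / 2 : ℝ) * (19 / 20 : ℝ) ^ 14 := by norm_num
    nlinarith
  have hr14 : 0 < r ^ 14 := by positivity
  have hinv : (r⁻¹) ^ 14 = (r ^ 14)⁻¹ := by rw [inv_pow]
  have hinv8 : (r⁻¹) ^ 8 = r ^ 6 * (r ^ 14)⁻¹ := by
    rw [inv_pow]; field_simp
  rw [hinv, hinv8]
  rw [show (13 : ℝ) * (r ^ 14)⁻¹ - 7 * (r ^ 6 * (r ^ 14)⁻¹) = (13 - 7 * r ^ 6) * (r ^ 14)⁻¹ by ring]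
  rw [mul_inv_le_iff₀ hr14]
  linarith

/-- `−14/25 ≤ V′(r)/r` on `[19/20, 21/20]`. [folklore] -/
theorem lj_deriv_div_ge_on_tube40 {r : ℝ} (h1 : 19 / 20 ≤ r) (h2 : r ≤ 21 / 20) :
    -(14 / 25) ≤ deriv lennardJones r / r := by
  have hr : 0 < r := by linarith
  have _h := h2
  rw [deriv_lennardJones hr.ne']
  -- `(−r⁻¹³ + r⁻⁷)/r = (r⁶ − 1) r⁻¹⁴ ≥ −(14/25)` ⟸ `r⁶ − 1 ≥ −(14/25) r¹⁴` with `r ≥ 19/20`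
  have h6 : (19 / 20 : ℝ) ^ 6 ≤ r ^ 6 := pow_le_pow_left₀ (by norm_num) h1 6
  have h14 : (19 / 20 : ℝ) ^ 14 ≤ r ^ 14 := pow_le_pow_left₀ (by norm_num) h1 14
  have hkey : -(14 / 25 : ℝ) * r ^ 14 ≤ r ^ 6 - 1 := by
    have hc : -(14 / 25 : ℝ) * (19 / 20 : ℝ) ^ 14 ≤ (19 / 20 : ℝ) ^ 6 - 1 := by norm_num
    nlinarith
  have hr14 : 0 < r ^ 14 := by positivity
  have heq : (-(r⁻¹) ^ 13 + (r⁻¹) ^ 7) / r = (r ^ 6 - 1) * (r ^ 14)⁻¹ := by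
    rw [inv_pow, inv_pow]; field_simp; ring
  rw [heq, le_mul_inv_iff₀ hr14]
  linarith

/-- `V′(r)/r ≤ 13/50` on `[19/20, 21/20]` (true maximum `≈ 0.172`; the attractive transverse stiffness is small). [folklore] -/
theorem lj_deriv_div_le_on_tube40 {r : ℝ} (h1 : 19 / 20 ≤ r) (h2 : r ≤ 21 / 20) :
    deriv lennardJones r / r ≤ 13 / 50 := by
  have hr : 0 < r := by linarith
  rw [deriv_lennardJones hr.ne']
  have hr14 : 0 < r ^ 14 := by positivity
  have heq : (-(r⁻¹) ^ 13 + (r⁻¹) ^ 7) / r = (r ^ 6 - 1) * (r ^ 14)⁻¹ := by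
    rw [inv_pow, inv_pow]; field_simp; ring
  rw [heq, mul_inv_le_iff₀ hr14]
  -- `r⁶ − 1 ≤ (13/50) r¹⁴`: trivial for `r ≤ 1`; for `r ≥ 1`, `r¹⁴ ≥ r⁶` and `(37/50) r⁶ ≤ (37/50)(21/20)⁶ ≤ 1`
  by_cases hr1 : r ≤ 1
  · have h6 : r ^ 6 ≤ 1 := pow_le_one₀ hr.le hr1
    have h14' : 0 ≤ (13 / 50 : ℝ) * r ^ 14 := by positivity
    linarith
  · push Not at hr1
    have h6 : r ^ 6 ≤ (21 / 20 : ℝ) ^ 6 := pow_le_pow_left₀ hr.le h2 6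
    have h614 : r ^ 6 ≤ r ^ 14 := pow_le_pow_right₀ hr1.le (by norm_num)
    have hc : (37 / 50 : ℝ) * (21 / 20 : ℝ) ^ 6 ≤ 1 := by norm_num
    nlinarith

/-- **Per-bond split lower bound at tolerance `1/40`**: for `‖e‖ ∈ [19/20, 21/20]`,
`Hess₀ e w ≥ (9/5)·c² − (14/25)·(‖w‖² − c²)` with `c = ⟪e, w⟫/‖e‖` (longitudinal stiffness at least `1.8`, transverse
softening at most `0.56`). [folklore] -/
theorem Hess₀_ge_split_on_tube40 {e : EuclideanSpace ℝ (Fin 3)} (w : EuclideanSpace ℝ (Fin 3)) (h1 : 19 / 20 ≤ ‖e‖) (h2 : ‖e‖ ≤ 21 / 20) :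
    9 / 5 * (inner ℝ e w / ‖e‖) ^ 2 - 14 / 25 * (‖w‖ ^ 2 - (inner ℝ e w / ‖e‖) ^ 2) ≤ Hess₀ e w := by
  unfold Hess₀
  set c := inner ℝ e w / ‖e‖ with hc
  have hpos : 0 < ‖e‖ := by linarith
  have hc2 : c ^ 2 ≤ ‖w‖ ^ 2 := by
    have hcs : |inner ℝ e w| ≤ ‖e‖ * ‖w‖ := abs_real_inner_le_norm e w
    have : |c| ≤ ‖w‖ := by
      rw [hc, abs_div, abs_of_pos hpos, div_le_iff₀ hpos]; linarith [mul_comm ‖e‖ ‖w‖]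
    nlinarith [abs_nonneg c, sq_abs c]
  have hA := lj_deriv2_ge_on_tube40 h1 h2
  have hB := lj_deriv_div_ge_on_tube40 h1 h2
  have ht : 0 ≤ ‖w‖ ^ 2 - c ^ 2 := sub_nonneg.2 hc2
  nlinarith [mul_le_mul_of_nonneg_right hA (sq_nonneg c), mul_le_mul_of_nonneg_right hB ht]

/-- **No first-shell bond costs more than `0.56‖Δu‖²`** at tolerance `1/40`: `Hess₀ e w ≥ −(14/25)‖w‖²` for
`‖e‖ ∈ [19/20, 21/20]`. [folklore] -/
theorem Hess₀_ge_neg_on_tube40 {e : EuclideanSpace ℝ (Fin 3)} (w : EuclideanSpace ℝ (Fin 3)) (h1 : 19 / 20 ≤ ‖e‖) (h2 : ‖e‖ ≤ 21 / 20) :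
    -(14 / 25) * ‖w‖ ^ 2 ≤ Hess₀ e w := by
  have h := Hess₀_ge_split_on_tube40 w h1 h2
  nlinarith [sq_nonneg (inner ℝ e w / ‖e‖)]

end Summit.AtomisticToContinuum.Crystallization.Theorems.NashClassCertificatesNashNearField

end
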